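import Mathlib
import Literature.Analysis.FluidPDE.TypeIAncientMild
import Literature.Analysis.FluidPDE.OseenSlice
import HarnessLib

/-!
# Route SymmetryModuliCount — crux `HelicalEndLiouville` (stmt-NavierStokesRegularity-14062),
# line `vanishing-cell-reynolds`, stub 2: cell gaps in sup norm

For a vector `L` and a function `h` on `ℝ³` write `Π₀ h (x) = ∫₀¹ h (x + rL) dr` for the average
over one period cell along `L`; `h − Π₀ h` is the *cell oscillation*. We prove
(`stub_cellGaps`) that there is one absolute constant `κ > 0` such that for `L`-periodic bounded
continuous data

* (i) the cell oscillation of the heat flow `e^{σΔ} g` is `≤ κ ‖L‖² σ⁻¹ ‖g‖_∞`;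
* (ii) the cell oscillation of one Oseen slice `N_σ[f, g] = e^{σΔ} P∇·(f ⊗ g)` is
  `≤ κ · min(σ^{-1/2}, ‖L‖² σ^{-3/2}) · ‖f‖_∞ ‖g‖_∞`.

Proof. *Wirtinger's inequality in sup norm* (`cellGaps_norm_sub_cellAverage_le`): if `h` is
`C²`, `L`-periodic and `‖D²h‖ ≤ D`, then `‖h(x) − Π₀h(x)‖ ≤ ‖L‖² D`. Indeed
`φ(r) = h(x + rL)` is `C²` with `φ(1) = φ(0)` and `‖φ''‖ ≤ ‖L‖² D`; the derivative `φ'` has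
zero average over `[0, 1]`, so `φ'(s) = ∫₀¹ (φ'(s) − φ'(r)) dr` has norm `≤ ‖L‖² D` on `[0, 1]`
(mean value inequality), and `φ(0) − ∫₀¹ φ = ∫₀¹ (φ(0) − φ(r)) dr` has norm `≤ sup ‖φ'‖`
(`cellGaps_norm_sub_intervalIntegral_le`). (i) follows with the tree bound
`‖D² e^{σΔ} g‖ ≤ A σ⁻¹ ‖g‖_∞` (`exists_norm_iteratedFDeriv_heatExtension_le 2`), smoothness
`contDiff_heatExtension_holds` and translation covariance of the heat flow. (ii): the slice is
bounded by `C₀ σ^{-1/2} ‖f‖_∞‖g‖_∞` (`exists_norm_oseenSlice_le`), whence the oscillation is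
`≤ 2C₀ σ^{-1/2} ‖f‖_∞‖g‖_∞`; and it is smooth (`contDiff_oseenSlice`), `L`-periodic
(`oseenSlice_eq_integral_sub`) with `‖D² N_σ‖ ≤ C₂ σ^{-3/2} ‖f‖_∞‖g‖_∞`
(`exists_norm_iteratedFDeriv_oseenSlice_le 2`), whence Wirtinger gives
`≤ C₂ ‖L‖² σ^{-3/2} ‖f‖_∞‖g‖_∞`. Take `κ = A + 2C₀ + C₂ + 1`.

References: Koch–Nadirashvili–Seregin–Šverák, Acta Math. 203 (2009), §3–§4 (the slice bounds);
the Wirtinger/Poincaré step is elementary calculus.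
-/

noncomputable section

-- the summit and its single sub-problem share the name (CONVENTIONS §1), as in every Theorems file
set_option linter.dupNamespace false

open Set MeasureTheory Function Filter
open Literature.Analysis.FluidPDE
open Literature.Analysis.UnboundedOperators (heatExtension)
open scoped RealInnerProductSpace Topology

namespace Summit.NavierStokesRegularity.NavierStokesRegularity.Theorems

local notation "E3" => EuclideanSpace ℝ (Fin 3)

section Wirtinger

variable {F : Type*} [NormedAddCommGroup F] [NormedSpace ℝ F] [CompleteSpace F]

/-- **Poincaré–Wirtinger in sup norm on the unit cell, one variable.** If `φ : ℝ → F` is twice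
differentiable with `φ 1 = φ 0` and `‖φ''‖ ≤ B` everywhere, then `‖φ 0 − ∫₀¹ φ‖ ≤ B`
(`φ'` has zero average on `[0,1]`, so `‖φ'‖ ≤ B` there by the mean value inequality, and
`φ 0 − ∫₀¹ φ = ∫₀¹ (φ 0 − φ r) dr`). [folklore] -/
theorem cellGaps_norm_sub_intervalIntegral_le {φ ψ ψ' : ℝ → F} {B : ℝ}
    (hφ : ∀ r, HasDerivAt φ (ψ r) r) (hψ : ∀ r, HasDerivAt ψ (ψ' r) r)
    (hB : ∀ r, ‖ψ' r‖ ≤ B) (h01 : φ 1 = φ 0) :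
    ‖φ 0 - ∫ r in (0:ℝ)..1, φ r‖ ≤ B := by
  have hψc : Continuous ψ := continuous_iff_continuousAt.2 fun r => (hψ r).continuousAt
  have hφc : Continuous φ := continuous_iff_continuousAt.2 fun r => (hφ r).continuousAt
  have hB0 : 0 ≤ B := (norm_nonneg _).trans (hB 0)
  -- the derivative has zero cell average
  have hint : ∫ r in (0:ℝ)..1, ψ r = 0 := by
    rw [intervalIntegral.integral_eq_sub_of_hasDerivAt (fun r _ => hφ r)
      (hψc.intervalIntegrable _ _), h01, sub_self]
  -- the derivative is `B`-Lipschitz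
  have hlip : ∀ r s : ℝ, ‖ψ s - ψ r‖ ≤ B * ‖s - r‖ := fun r s =>
    convex_univ.norm_image_sub_le_of_norm_hasDerivWithin_le
      (fun t _ => (hψ t).hasDerivWithinAt) (fun t _ => hB t) (mem_univ r) (mem_univ s)
  -- hence bounded by `B` on the cell
  have hψB : ∀ s ∈ Icc (0:ℝ) 1, ‖ψ s‖ ≤ B := by
    intro s hs
    have hrepr : ψ s = ∫ r in (0:ℝ)..1, (ψ s - ψ r) := by
      rw [intervalIntegral.integral_sub intervalIntegrable_const (hψc.intervalIntegrable _ _),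
        hint, intervalIntegral.integral_const, sub_zero, sub_zero, one_smul]
    rw [hrepr]
    have key := intervalIntegral.norm_integral_le_of_norm_le_const (a := (0:ℝ)) (b := 1)
      (C := B) (f := fun r => ψ s - ψ r) fun r hr => ?_
    · simpa using key
    · rw [uIoc_of_le zero_le_one] at hr
      calc ‖ψ s - ψ r‖ ≤ B * ‖s - r‖ := hlip r s
        _ ≤ B * 1 := by
          refine mul_le_mul_of_nonneg_left ?_ hB0
          rw [Real.norm_eq_abs, abs_le]
          constructor <;> linarith [hs.1, hs.2, hr.1, hr.2]
        _ = B := mul_one B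
  -- mean value inequality for `φ` on the cell
  have hφB : ∀ r ∈ Icc (0:ℝ) 1, ‖φ r - φ 0‖ ≤ B * (r - 0) :=
    norm_image_sub_le_of_norm_deriv_le_segment' (fun r _ => (hφ r).hasDerivWithinAt)
      fun r hr => hψB r (Ico_subset_Icc_self hr)
  have hrepr : φ 0 - ∫ r in (0:ℝ)..1, φ r = ∫ r in (0:ℝ)..1, (φ 0 - φ r) := by
    rw [intervalIntegral.integral_sub intervalIntegrable_const (hφc.intervalIntegrable _ _),
      intervalIntegral.integral_const, sub_zero, one_smul]
  rw [hrepr]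
  have key := intervalIntegral.norm_integral_le_of_norm_le_const (a := (0:ℝ)) (b := 1) (C := B)
    (f := fun r => φ 0 - φ r) fun r hr => ?_
  · simpa using key
  · rw [uIoc_of_le zero_le_one] at hr
    rw [norm_sub_rev]
    calc ‖φ r - φ 0‖ ≤ B * (r - 0) := hφB r (Ioc_subset_Icc_self hr)
      _ ≤ B * 1 := mul_le_mul_of_nonneg_left (by linarith [hr.2]) hB0
      _ = B := mul_one B

variable {E : Type*} [NormedAddCommGroup E] [NormedSpace ℝ E]

/-- **Wirtinger's inequality in sup norm (Poincaré gap of the period cell).** If `h : E → F` is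
`C²`, `L`-periodic and `‖D²h‖ ≤ D` everywhere, then the cell oscillation is small:
`‖h x − ∫₀¹ h (x + rL) dr‖ ≤ ‖L‖² D` (restrict to the line `r ↦ x + rL` and apply
`cellGaps_norm_sub_intervalIntegral_le` with `‖φ''(r)‖ = ‖D²h(x + rL)[L, L]‖ ≤ ‖L‖² D`). [folklore] -/
theorem cellGaps_norm_sub_cellAverage_le {h : E → F} (hh : ContDiff ℝ 2 h) {L : E}
    (hper : ∀ x, h (x + L) = h x) {D : ℝ} (hD : ∀ y, ‖iteratedFDeriv ℝ 2 h y‖ ≤ D) (x : E) :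
    ‖h x - ∫ r in (0:ℝ)..1, h (x + r • L)‖ ≤ ‖L‖ ^ 2 * D := by
  have hγ : ∀ r : ℝ, HasDerivAt (fun r : ℝ => x + r • L) L r := fun r => by
    simpa using ((hasDerivAt_id r).smul_const L).const_add x
  have hd1 : Differentiable ℝ h := hh.differentiable (by simp)
  have hd2 : Differentiable ℝ (fderiv ℝ h) :=
    (hh.fderiv_right (m := 1) (by norm_num)).differentiable (by simp)
  have hφ : ∀ r, HasDerivAt (fun r : ℝ => h (x + r • L)) (fderiv ℝ h (x + r • L) L) r :=
    fun r => (hd1 _).hasFDerivAt.comp_hasDerivAt r (hγ r)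
  have hψ : ∀ r, HasDerivAt (fun r : ℝ => fderiv ℝ h (x + r • L) L)
      (fderiv ℝ (fderiv ℝ h) (x + r • L) L L) r := fun r => by
    have h1 : HasDerivAt (fun r : ℝ => fderiv ℝ h (x + r • L))
        (fderiv ℝ (fderiv ℝ h) (x + r • L) L) r :=
      (hd2 _).hasFDerivAt.comp_hasDerivAt r (hγ r)
    exact (ContinuousLinearMap.apply ℝ F L).hasFDerivAt.comp_hasDerivAt r h1
  have hB : ∀ r : ℝ, ‖fderiv ℝ (fderiv ℝ h) (x + r • L) L L‖ ≤ ‖L‖ ^ 2 * D := fun r => by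
    have h2 : ‖fderiv ℝ (fderiv ℝ h) (x + r • L)‖ ≤ D := by
      have e1 : ‖iteratedFDeriv ℝ 1 (fderiv ℝ h) (x + r • L)‖ =
          ‖iteratedFDeriv ℝ 2 h (x + r • L)‖ := norm_iteratedFDeriv_fderiv
      rw [norm_iteratedFDeriv_one] at e1
      exact e1 ▸ hD _
    calc ‖fderiv ℝ (fderiv ℝ h) (x + r • L) L L‖
        ≤ ‖fderiv ℝ (fderiv ℝ h) (x + r • L)‖ * ‖L‖ * ‖L‖ :=
          ContinuousLinearMap.le_opNorm₂ _ _ _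
      _ ≤ D * ‖L‖ * ‖L‖ := by gcongr
      _ = ‖L‖ ^ 2 * D := by ring
  have h01 : (fun r : ℝ => h (x + r • L)) 1 = (fun r : ℝ => h (x + r • L)) 0 := by
    simp only [one_smul, zero_smul, add_zero, hper]
  have key := cellGaps_norm_sub_intervalIntegral_le hφ hψ hB h01
  simpa only [zero_smul, add_zero] using key

omit [CompleteSpace F] in
/-- The trivial bound of the cell oscillation of a bounded function: if `‖N y‖ ≤ B` everywhere
then `‖N x − ∫₀¹ N (x + rL) dr‖ ≤ 2B`. [folklore] -/
theorem cellGaps_norm_sub_cellAverage_le_two_mul {N : E → F} {B : ℝ} (hB : ∀ y, ‖N y‖ ≤ B)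
    (L x : E) : ‖N x - ∫ r in (0:ℝ)..1, N (x + r • L)‖ ≤ 2 * B := by
  have key := intervalIntegral.norm_integral_le_of_norm_le_const (a := (0:ℝ)) (b := 1) (C := B)
    (f := fun r => N (x + r • L)) fun r _ => hB _
  have h1 : ‖∫ r in (0:ℝ)..1, N (x + r • L)‖ ≤ B := by simpa using key
  calc ‖N x - ∫ r in (0:ℝ)..1, N (x + r • L)‖ ≤ ‖N x‖ + ‖∫ r in (0:ℝ)..1, N (x + r • L)‖ :=
        norm_sub_le _ _
    _ ≤ B + B := add_le_add (hB x) h1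
    _ = 2 * B := by ring

end Wirtinger

/-! ### The two kernel facts on `ℝ³` -/

/-- **The heat flow commutes with translations**: `e^{tΔ}(g(· + a))(y) = (e^{tΔ}g)(y + a)` (both
sides are the same convolution integral; Evans, *PDE*, §2.3.1). [folklore] -/
theorem cellGaps_heatExtension_comp_add_right (g : E3 → E3) (a : E3) (t : ℝ) (y : E3) :
    heatExtension (fun x => g (x + a)) t y = heatExtension g t (y + a) := by
  -- adapted from `Literature.Analysis.FluidPDE.heatExtension_comp_add_right`
  -- (Literature/Analysis/FluidPDE/KatoSymmetryCovariance.lean), reproved to keep imports light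
  rw [Literature.Analysis.UnboundedOperators.heatExtension_apply,
    Literature.Analysis.UnboundedOperators.heatExtension_apply]
  congr 1
  funext z
  rw [sub_add_eq_add_sub]

/-- The heat flow of an `L`-periodic function is `L`-periodic. [folklore] -/
theorem cellGaps_heatExtension_periodic {g : E3 → E3} {L : E3} (hper : ∀ x, g (x + L) = g x)
    (t : ℝ) (y : E3) : heatExtension g t (y + L) = heatExtension g t y := by
  rw [← cellGaps_heatExtension_comp_add_right g L t y]
  exact congrArg (fun φ : E3 → E3 => heatExtension φ t y) (funext hper)

/-- The Oseen slice of `L`-periodic fields is `L`-periodic (translation invariance of the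
kernel, `oseenSlice_eq_integral_sub`). [folklore] -/
theorem cellGaps_oseenSlice_periodic (σ : ℝ) {f g : E3 → E3} {L : E3}
    (hf : ∀ x, f (x + L) = f x) (hg : ∀ x, g (x + L) = g x) (y : E3) :
    oseenSlice σ f g (y + L) = oseenSlice σ f g y := by
  rw [oseenSlice_eq_integral_sub, oseenSlice_eq_integral_sub]
  refine integral_congr_ae (Eventually.of_forall fun z => ?_)
  simp only [add_sub_right_comm, hf, hg]

/-- **Heat cell gap.** With the constant `A` of `exists_norm_iteratedFDeriv_heatExtension_le 2`
(`‖D² e^{σΔ}g‖ ≤ A σ⁻¹ ‖g‖_∞`): the cell oscillation of the heat flow of `L`-periodic bounded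
continuous data is `≤ A ‖L‖² σ⁻¹ M`. [folklore] -/
theorem cellGaps_heat {A : ℝ}
    (hA : ∀ ⦃t : ℝ⦄, 0 < t → ∀ ⦃f : E3 → E3⦄ ⦃C : ℝ⦄, AEStronglyMeasurable f volume →
      (∀ z, ‖f z‖ ≤ C) → ∀ x, ‖iteratedFDeriv ℝ 2 (heatExtension f t) x‖ ≤ A * t ^ (-(2 : ℝ) / 2) * C)
    (L : E3) (g : E3 → E3) (M σ : ℝ) (hg : Continuous g) (hper : ∀ x, g (x + L) = g x)
    (hM : ∀ x, ‖g x‖ ≤ M) (hσ : 0 < σ) (x : E3) :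
    ‖heatExtension g σ x - ∫ r in (0:ℝ)..1, heatExtension g σ (x + r • L)‖ ≤
      A * (‖L‖ ^ 2 / σ) * M := by
  have hmem : MemLp g ⊤ (volume : Measure E3) :=
    memLp_top_of_bound hg.aestronglyMeasurable M (Eventually.of_forall hM)
  have hsmooth : ContDiff ℝ 2 (heatExtension g σ) :=
    contDiff_infty.1
      (Literature.Analysis.UnboundedOperators.contDiff_heatExtension_holds hmem le_top hσ) 2
  have hD : ∀ y, ‖iteratedFDeriv ℝ 2 (heatExtension g σ) y‖ ≤ A * σ⁻¹ * M := fun y => by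
    have := hA hσ hg.aestronglyMeasurable hM y
    rwa [show (-(2 : ℝ) / 2) = -1 by norm_num, Real.rpow_neg_one] at this
  calc ‖heatExtension g σ x - ∫ r in (0:ℝ)..1, heatExtension g σ (x + r • L)‖
      ≤ ‖L‖ ^ 2 * (A * σ⁻¹ * M) :=
        cellGaps_norm_sub_cellAverage_le hsmooth (cellGaps_heatExtension_periodic hper σ) hD x
    _ = A * (‖L‖ ^ 2 / σ) * M := by ring

/-- **Oseen cell gap.** With the constants `C₀` of `exists_norm_oseenSlice_le`
(`‖N_σ‖ ≤ C₀ σ^{-1/2} M_f M_g`) and `C₂` of `exists_norm_iteratedFDeriv_oseenSlice_le 2`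
(`‖D² N_σ‖ ≤ C₂ σ^{-3/2} M_f M_g`): the cell oscillation of the slice of `L`-periodic bounded
continuous fields is `≤ max(2C₀, C₂) · min(σ^{-1/2}, ‖L‖² σ^{-3/2}) · M_f M_g`.
[cite: KochNadirashviliSereginSverak2009, §3 (3.5), Prop. 4.1 and Remark 4.2 (arXiv:0709.3599v1)] -/
theorem cellGaps_oseen {C₀ C₂ κ : ℝ}
    (hC₀ : ∀ {σ : ℝ}, 0 < σ → ∀ {a b : E3 → E3} {Ma Mb : ℝ},
      (∀ y, ‖a y‖ ≤ Ma) → (∀ y, ‖b y‖ ≤ Mb) → ∀ x,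
        ‖oseenSlice σ a b x‖ ≤ C₀ * σ ^ (-(1 / 2 : ℝ)) * Ma * Mb)
    (hC₂ : ∀ {σ : ℝ}, 0 < σ → ∀ {a b : E3 → E3} {Ma Mb : ℝ},
      Measurable a → Measurable b → (∀ y, ‖a y‖ ≤ Ma) → (∀ y, ‖b y‖ ≤ Mb) → ∀ x,
        ‖iteratedFDeriv ℝ 2 (oseenSlice σ a b) x‖ ≤ C₂ * σ ^ (-((2 : ℝ) + 1) / 2) * Ma * Mb)
    (h₀ : 2 * C₀ ≤ κ) (h₂ : C₂ ≤ κ)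
    (L : E3) (f g : E3 → E3) (Mf Mg σ : ℝ) (hf : Continuous f) (hg : Continuous g)
    (hfL : ∀ x, f (x + L) = f x) (hgL : ∀ x, g (x + L) = g x) (hMf : ∀ x, ‖f x‖ ≤ Mf)
    (hMg : ∀ x, ‖g x‖ ≤ Mg) (hσ : 0 < σ) (x : E3) :
    ‖oseenSlice σ f g x - ∫ r in (0:ℝ)..1, oseenSlice σ f g (x + r • L)‖ ≤
      κ * min (σ ^ (-(1 / 2 : ℝ))) (‖L‖ ^ 2 * σ ^ (-(3 / 2 : ℝ))) * Mf * Mg := by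
  have hMf0 : 0 ≤ Mf := (norm_nonneg _).trans (hMf 0)
  have hMg0 : 0 ≤ Mg := (norm_nonneg _).trans (hMg 0)
  -- branch 1: the sup bound
  have hb1 : ‖oseenSlice σ f g x - ∫ r in (0:ℝ)..1, oseenSlice σ f g (x + r • L)‖ ≤
      2 * C₀ * σ ^ (-(1 / 2 : ℝ)) * Mf * Mg := by
    have := cellGaps_norm_sub_cellAverage_le_two_mul (hC₀ hσ hMf hMg) L x
    linarith
  -- branch 2: Wirtinger
  have hsmooth : ContDiff ℝ 2 (oseenSlice σ f g) :=
    contDiff_oseenSlice hσ hf.measurable hg.measurable hMf hMg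
  have hD : ∀ y, ‖iteratedFDeriv ℝ 2 (oseenSlice σ f g) y‖ ≤ C₂ * σ ^ (-(3 / 2 : ℝ)) * Mf * Mg :=
    fun y => by
    have := hC₂ hσ hf.measurable hg.measurable hMf hMg y
    rwa [show (-((2 : ℝ) + 1) / 2) = -(3 / 2 : ℝ) by norm_num] at this
  have hb2 : ‖oseenSlice σ f g x - ∫ r in (0:ℝ)..1, oseenSlice σ f g (x + r • L)‖ ≤
      ‖L‖ ^ 2 * (C₂ * σ ^ (-(3 / 2 : ℝ)) * Mf * Mg) :=
    cellGaps_norm_sub_cellAverage_le hsmooth (cellGaps_oseenSlice_periodic σ hfL hgL) hD x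
  have hs1 : 0 ≤ σ ^ (-(1 / 2 : ℝ)) := Real.rpow_nonneg hσ.le _
  have hs3 : 0 ≤ σ ^ (-(3 / 2 : ℝ)) := Real.rpow_nonneg hσ.le _
  rcases min_choice (σ ^ (-(1 / 2 : ℝ))) (‖L‖ ^ 2 * σ ^ (-(3 / 2 : ℝ))) with hmin | hmin <;>
    rw [hmin]
  · calc _ ≤ 2 * C₀ * σ ^ (-(1 / 2 : ℝ)) * Mf * Mg := hb1
      _ ≤ κ * σ ^ (-(1 / 2 : ℝ)) * Mf * Mg := by gcongr
  · calc _ ≤ ‖L‖ ^ 2 * (C₂ * σ ^ (-(3 / 2 : ℝ)) * Mf * Mg) := hb2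
      _ = C₂ * (‖L‖ ^ 2 * σ ^ (-(3 / 2 : ℝ))) * Mf * Mg := by ring
      _ ≤ κ * (‖L‖ ^ 2 * σ ^ (-(3 / 2 : ℝ))) * Mf * Mg := by gcongr

/-- **Stub 2 (cell gaps in sup norm).** One absolute `κ > 0` such that for `L`-periodic bounded
continuous data (i) the cell oscillation of the heat flow is `≤ κ ‖L‖² σ⁻¹ M` and (ii) the cell
oscillation of one Oseen slice `N_σ[f, g]` is `≤ κ · min(σ^{-1/2}, ‖L‖² σ^{-3/2}) · M_f M_g`
(Wirtinger in sup norm for an `L`-periodic `C²` function, `‖h − Π₀h‖_∞ ≤ ‖L‖² ‖D²h‖_∞`, and the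
tree bounds `‖D² e^{σΔ}g‖ ≤ A₂σ⁻¹‖g‖_∞`, `‖N_σ‖ ≤ C₀σ^{-1/2}M_fM_g`, `‖D²N_σ‖ ≤ C₂σ^{-3/2}M_fM_g`). [folklore] -/
theorem stub_cellGaps :
    ∃ κ : ℝ, 0 < κ ∧
      (∀ (L : E3) (g : E3 → E3) (M σ : ℝ), Continuous g → (∀ x, g (x + L) = g x) →
        (∀ x, ‖g x‖ ≤ M) → 0 < σ → ∀ x : E3,
          ‖heatExtension g σ x - ∫ r in (0:ℝ)..1, heatExtension g σ (x + r • L)‖ ≤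
            κ * (‖L‖ ^ 2 / σ) * M) ∧
      (∀ (L : E3) (f g : E3 → E3) (Mf Mg σ : ℝ), Continuous f → Continuous g →
        (∀ x, f (x + L) = f x) → (∀ x, g (x + L) = g x) → (∀ x, ‖f x‖ ≤ Mf) →
        (∀ x, ‖g x‖ ≤ Mg) → 0 < σ → ∀ x : E3,
          ‖oseenSlice σ f g x - ∫ r in (0:ℝ)..1, oseenSlice σ f g (x + r • L)‖ ≤
            κ * min (σ ^ (-(1 / 2 : ℝ))) (‖L‖ ^ 2 * σ ^ (-(3 / 2 : ℝ))) * Mf * Mg) := by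
  obtain ⟨A, hA0, hA⟩ :=
    Literature.Analysis.UnboundedOperators.exists_norm_iteratedFDeriv_heatExtension_le
      (E := E3) (F := E3) 2
  obtain ⟨C₀, hC₀0, hC₀⟩ := exists_norm_oseenSlice_le (E := E3)
  obtain ⟨C₂, hC₂0, hC₂⟩ := exists_norm_iteratedFDeriv_oseenSlice_le (E := E3) 2
  have hA' : ∀ ⦃t : ℝ⦄, 0 < t → ∀ ⦃f : E3 → E3⦄ ⦃C : ℝ⦄, AEStronglyMeasurable f volume →
      (∀ z, ‖f z‖ ≤ C) → ∀ x,
        ‖iteratedFDeriv ℝ 2 (heatExtension f t) x‖ ≤ A * t ^ (-(2 : ℝ) / 2) * C := by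
    intro t ht f C hf hC x
    exact_mod_cast hA ht hf hC x
  have hC₂' : ∀ {σ : ℝ}, 0 < σ → ∀ {a b : E3 → E3} {Ma Mb : ℝ},
      Measurable a → Measurable b → (∀ y, ‖a y‖ ≤ Ma) → (∀ y, ‖b y‖ ≤ Mb) → ∀ x,
        ‖iteratedFDeriv ℝ 2 (oseenSlice σ a b) x‖ ≤ C₂ * σ ^ (-((2 : ℝ) + 1) / 2) * Ma * Mb := by
    intro σ hσ a b Ma Mb ha hb hMa hMb x
    exact_mod_cast hC₂ hσ ha hb hMa hMb x
  refine ⟨A + 2 * C₀ + C₂ + 1, by positivity, ?_, ?_⟩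
  · intro L g M σ hg hper hM hσ x
    have hM0 : 0 ≤ M := (norm_nonneg _).trans (hM 0)
    calc _ ≤ A * (‖L‖ ^ 2 / σ) * M := cellGaps_heat hA' L g M σ hg hper hM hσ x
      _ ≤ (A + 2 * C₀ + C₂ + 1) * (‖L‖ ^ 2 / σ) * M := by
        gcongr
        linarith
  · intro L f g Mf Mg σ hf hg hfL hgL hMf hMg hσ x
    exact cellGaps_oseen hC₀ hC₂' (by linarith) (by linarith) L f g Mf Mg σ hf hg hfL hgL
      hMf hMg hσ x

end Summit.NavierStokesRegularity.NavierStokesRegularity.Theorems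

end
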